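import Summits.PneNP.PneNP.Theorems.Capture.Negative.GateLocality
import Summits.PneNP.PneNP.Theorems.Capture.Negative.BoundedFanIn

/-!
# `Capture` (stmt-PneNP-2659, route PneNP/ConvexRankGates) — negative-side lemmas: the width of the linear-algebra gates is load-bearing

Standing-adversary (cdisprove, gen 2) output for the crux
`Summit.PneNP.PneNP.Theses.ConvexRankGates.Capture`. STRENGTHENING S₃ of the crux — the simulating
circuit may use `∧₂, ∨₂`, CONV gates of fan-in `≤ k`, and PERM / GRANK gates of a FIXED width `s₀` but
of ANY fan-in — is FALSE for every `s₀, k` (`not_captureFixedWidth`). Mechanism: PERM and GRANK gates are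
LOCAL (`GateLocality.lean`: minterms of `≤ log₂ s₀!` resp. `≤ s₀` wires), position-locality transfers to
wire-locality by monotonicity, an `L`-local monotone map on `R` candidate wires is a `{∧₂,∨₂,0,1}`-DNF of
size `(R+1)^L (L+2) + 1` (`cktSize_of_wireLocal`), and gate-by-gate rebasing (`BoundedFanIn.lean`) plus
constant elimination turns the simulating circuit into a polynomial monotone one — refuted by the tree's
proved Tardos gap (`Literature.Barriers.PneNP.not_monotoneTransfer_pow_holds`). So any proof of `Capture`
must let the WIDTH of its PERM/GRANK gates grow with `t + n` (or use CONV gates of unbounded fan-in): the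
parameter `(t+n+2)^a` inside `Ext` is load-bearing for the linear-algebra gates, not only through CONV.

* §1 `cktSize_bigAnd`, `cktSize_bigOr`, `cktSize_dnf` — DNF builders.
* §2 `listed`, `cktSize_of_wireLocal` — local monotone maps are polynomial DNF gadgets.
* §3 `fixedWidthBasis`, `CaptureFixedWidth`, `not_captureFixedWidth`.

Companions: `LoadBearing.lean`, `GateLocality.lean`, `BoundedFanIn.lean`; crux work file
`Cruxes/Capture/Disproof.lean` (§10–§12 there). Refuter seat cdisprove-stmt-PneNP-2659-g2, 2026-08-16.
-/

namespace Summit.PneNP.PneNP.Theorems.Capture.Negative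

open Literature.Computability.Complexity Literature.Computability.Complexity.GateList
  Literature.Barriers.PneNP Filter Finset

/-! ## §1 DNF builders over `{∧₂,∨₂,0,1}` -/

section DNFGadget

variable {κ : Type*}

/-- `y u ∧ y w` costs one gate. [folklore] -/
theorem cktSize_and01 (u w : κ) :
    CktSize monotoneBasis01 (fun (y : κ → Bool) (_ : Unit) => (y u && y w)) 1 :=
  (CktSize.gate (B := monotoneBasis01) (GateFn.and 2) and_mem_monotoneBasis01 ![u, w]).congr
    fun y _ => by
      simp only [GateFn.and, Fin.forall_fin_two, Matrix.cons_val_zero, Matrix.cons_val_one,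
        Bool.decide_and, Bool.decide_eq_true]

/-- `y u ∨ y w` costs one gate. [folklore] -/
theorem cktSize_or01 (u w : κ) :
    CktSize monotoneBasis01 (fun (y : κ → Bool) (_ : Unit) => (y u || y w)) 1 :=
  (CktSize.gate (B := monotoneBasis01) (GateFn.or 2) or_mem_monotoneBasis01 ![u, w]).congr
    fun y _ => by
      simp only [GateFn.or, Fin.exists_fin_two, Matrix.cons_val_zero, Matrix.cons_val_one,
        Bool.decide_or, Bool.decide_eq_true]

/-- **Big AND** of a list of wires: `#list + 1` gates. [folklore] -/
theorem cktSize_bigAnd : ∀ l : List κ,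
    CktSize monotoneBasis01 (fun (y : κ → Bool) (_ : Unit) => l.all fun w => y w) (l.length + 1)
  | [] => (cktSize_const_of_mem κ (const_mem_monotoneBasis01 true)).congr fun _ _ => rfl
  | w :: l => by
    have h1 : CktSize monotoneBasis01 (fun (y : κ → Bool) =>
        Sum.elim y (fun (_ : Unit) => l.all fun w => y w)) (0 + (l.length + 1)) :=
      (CktSize.id monotoneBasis01).pair (cktSize_bigAnd l)
    have h2 := h1.comp (cktSize_and01 (κ := κ ⊕ Unit) (.inl w) (.inr ()))
    refine (h2.of_le (by simp)).congr fun y _ => ?_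
    simp [List.all_cons]

/-- **Big OR** of `M` wires: `M + 1` gates. [folklore] -/
theorem cktSize_bigOr : ∀ M : ℕ,
    CktSize monotoneBasis01 (fun (z : Fin M → Bool) (_ : Unit) => decide (∃ i, z i = true)) (M + 1)
  | 0 => (cktSize_const_of_mem (Fin 0) (const_mem_monotoneBasis01 false)).congr fun _ _ => by simp
  | M + 1 => by
    have h0 : CktSize monotoneBasis01 (fun (z : Fin (M + 1) → Bool) (_ : Unit) =>
        decide (∃ i : Fin M, z i.castSucc = true)) (M + 1) :=
      (cktSize_bigOr M).rewire Fin.castSucc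
    have h1 : CktSize monotoneBasis01 (fun (z : Fin (M + 1) → Bool) =>
        Sum.elim z (fun (_ : Unit) => decide (∃ i : Fin M, z i.castSucc = true))) (0 + (M + 1)) :=
      (CktSize.id monotoneBasis01).pair h0
    have h2 := h1.comp (cktSize_or01 (κ := Fin (M + 1) ⊕ Unit) (.inl (Fin.last M)) (.inr ()))
    refine (h2.of_le (by omega)).congr fun z _ => ?_
    simp only [Sum.elim_inl, Sum.elim_inr]
    rw [Bool.eq_iff_iff]
    simp only [Bool.or_eq_true, decide_eq_true_eq]
    constructor
    · rintro (h | ⟨i, hi⟩)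
      · exact ⟨_, h⟩
      · exact ⟨_, hi⟩
    · rintro ⟨i, hi⟩
      rcases Fin.eq_castSucc_or_eq_last i with ⟨j, rfl⟩ | rfl
      · exact Or.inr ⟨j, hi⟩
      · exact Or.inl hi

/-- **DNF** of `M` terms given as lists: `∑ (#termᵢ + 1) + (M + 1)` gates; with terms of length `≤ L`:
`≤ M·(L+2) + 1`. [folklore] -/
theorem cktSize_dnf {M L : ℕ} (term : Fin M → List κ) (hL : ∀ i, (term i).length ≤ L) :
    CktSize monotoneBasis01 (fun (y : κ → Bool) (_ : Unit) =>
      decide (∃ i, (term i).all (fun w => y w) = true)) (M * (L + 2) + 1) := by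
  have h1 : CktSize monotoneBasis01 (fun (y : κ → Bool) (i : Fin M) => (term i).all fun w => y w)
      (∑ i : Fin M, ((term i).length + 1)) :=
    CktSize.pi_fin fun i => cktSize_bigAnd (term i)
  have h2 := h1.comp (cktSize_bigOr M)
  refine (h2.of_le ?_).congr fun y _ => rfl
  calc ∑ i : Fin M, ((term i).length + 1) + (M + 1) ≤ ∑ _i : Fin M, (L + 1) + (M + 1) := by
        gcongr with i; exact hL i
    _ = M * (L + 2) + 1 := by simp; ring

end DNFGadget

/-! ## §2 Wire-local monotone maps have polynomial `{∧₂,∨₂,0,1}`-gadgets -/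

section LocalGadget

variable {κ : Type*} [DecidableEq κ]

/-- The wire set listed by an enumeration `f : Fin L → Option S` (blanks allowed). [folklore] -/
def listed (S : Finset κ) {L : ℕ} (f : Fin L → Option S) : Finset κ :=
  Finset.univ.biUnion fun i => ((f i).map Subtype.val).toFinset

omit [DecidableEq κ] in
/-- An option lists at most one element. [folklore] -/
theorem card_toFinset_option_le [DecidableEq κ] (o : Option κ) : o.toFinset.card ≤ 1 := by
  cases o <;> simp

/-- Membership in the listed set. [folklore] -/
theorem mem_listed {S : Finset κ} {L : ℕ} {f : Fin L → Option S} {w : κ} :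
    w ∈ listed S f ↔ ∃ i, (f i).map Subtype.val = some w := by
  simp [listed, Option.mem_toFinset, Option.mem_def]

/-- The listed set lies inside `S`. [folklore] -/
theorem listed_subset {S : Finset κ} {L : ℕ} (f : Fin L → Option S) : listed S f ⊆ S := by
  intro w hw
  obtain ⟨i, hi⟩ := mem_listed.1 hw
  cases hfi : f i with
  | none => rw [hfi] at hi; simp at hi
  | some x => rw [hfi] at hi; simp only [Option.map_some, Option.some.injEq] at hi; exact hi ▸ x.2

/-- At most `L` wires are listed. [folklore] -/
theorem card_listed_le {S : Finset κ} {L : ℕ} (f : Fin L → Option S) : (listed S f).card ≤ L := by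
  calc (listed S f).card ≤ ∑ i : Fin L, (((f i).map Subtype.val).toFinset).card := Finset.card_biUnion_le
    _ ≤ ∑ _i : Fin L, 1 := Finset.sum_le_sum fun i _ => card_toFinset_option_le _
    _ = L := by simp

/-- Every `t ⊆ S` with `#t ≤ L` is listed by some enumeration. [folklore] -/
theorem exists_listed_eq {S : Finset κ} {L : ℕ} (t : Finset κ) (ht : t ⊆ S) (hL : t.card ≤ L) :
    ∃ f : Fin L → Option S, listed S f = t := by
  let e : t ≃ Fin t.card := t.equivFin
  refine ⟨fun i => if h : (i : ℕ) < t.card then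
      some ⟨(e.symm ⟨i, h⟩ : t).1, ht (e.symm ⟨i, h⟩).2⟩ else none, ?_⟩
  ext w
  rw [mem_listed]
  constructor
  · rintro ⟨i, hi⟩
    by_cases h : (i : ℕ) < t.card
    · rw [dif_pos h] at hi
      simp only [Option.map_some, Option.some.injEq] at hi
      exact hi ▸ (e.symm ⟨i, h⟩).2
    · rw [dif_neg h] at hi
      simp at hi
  · intro hw
    refine ⟨Fin.castLE hL (e ⟨w, hw⟩), ?_⟩
    have h : ((Fin.castLE hL (e ⟨w, hw⟩) : Fin L) : ℕ) < t.card := by simp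
    rw [dif_pos h]
    simp only [Option.map_some, Option.some.injEq]
    have : (⟨((Fin.castLE hL (e ⟨w, hw⟩) : Fin L) : ℕ), h⟩ : Fin t.card) = e ⟨w, hw⟩ := Fin.ext (by simp)
    rw [this, Equiv.symm_apply_apply]

/-- Size of the gadget for an `L`-local map on `R` candidate wires: `(R+1)^L (L+2) + 1`. [folklore] -/
def localBound (R L : ℕ) : ℕ := (R + 1) ^ L * (L + 2) + 1

/-- `localBound` is monotone in `R`. [folklore] -/
theorem localBound_mono_left {R R' : ℕ} (h : R ≤ R') (L : ℕ) : localBound R L ≤ localBound R' L := by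
  unfold localBound
  gcongr

/-- **Wire-local monotone maps are polynomial monotone DNFs.** If `h` is monotone and every accepted `y`
contains an accepted sub-selection `t ⊆ S` of at most `L` wires, then `h` has a `{∧₂,∨₂,0,1}`-program with
`≤ (#S + 1)^L (L + 2) + 1` gates: the OR, over the accepted enumerations `f : Fin L → Option S`, of the AND
of the listed wires. [folklore] -/
theorem cktSize_of_wireLocal (h : (κ → Bool) → Bool) (hmono : Monotone h) (S : Finset κ) (L : ℕ)
    (hloc : ∀ y, h y = true → ∃ t : Finset κ, t ⊆ S ∧ t.card ≤ L ∧ (∀ w ∈ t, y w = true) ∧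
      h (fun w => decide (w ∈ t)) = true) :
    CktSize monotoneBasis01 (fun y (_ : Unit) => h y) (localBound S.card L) := by
  classical
  let Acc := {f : Fin L → Option S // h (fun w => decide (w ∈ listed S f)) = true}
  set M := Fintype.card Acc with hM
  let e : Acc ≃ Fin M := Fintype.equivFin Acc
  let term : Fin M → List κ := fun i => (listed S (e.symm i).1).toList
  have hterm : ∀ i, (term i).length ≤ L := fun i => by
    simp only [term, Finset.length_toList]
    exact card_listed_le _
  have hdnf := cktSize_dnf term hterm
  have hMle : M ≤ (S.card + 1) ^ L := by
    calc M ≤ Fintype.card (Fin L → Option S) := Fintype.card_subtype_le _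
      _ = (S.card + 1) ^ L := by
          rw [Fintype.card_fun, Fintype.card_option, Fintype.card_coe, Fintype.card_fin]
  refine (hdnf.of_le (by unfold localBound; gcongr)).congr fun y _ => ?_
  -- correctness of the DNF
  rw [Bool.eq_iff_iff, decide_eq_true_iff]
  constructor
  · rintro ⟨i, hi⟩
    rw [List.all_eq_true] at hi
    have hle : (fun w => decide (w ∈ listed S (e.symm i).1)) ≤ y := fun w => by
      by_cases hw : w ∈ listed S (e.symm i).1
      · have := hi w (Finset.mem_toList.2 hw)
        simp [hw, this]
      · simp [hw]
    exact eq_true_of_le_of_eq_true (hmono hle) (e.symm i).2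
  · intro hy
    obtain ⟨t, htS, htL, hty, ht⟩ := hloc y hy
    obtain ⟨f, hf⟩ := exists_listed_eq t htS htL
    have hacc : h (fun w => decide (w ∈ listed S f)) = true := by rw [hf]; exact ht
    refine ⟨e ⟨f, hacc⟩, ?_⟩
    rw [List.all_eq_true]
    intro w hw
    simp only [term, Equiv.symm_apply_apply, Finset.mem_toList, hf] at hw
    exact hty w hw

end LocalGadget

/-! ## §3 STRENGTHENING S₃ — PERM/GRANK gates of FIXED width `s₀` (any fan-in) plus any wide gates of
fan-in `≤ k`: FALSE for every `s₀, k` (locality ⇒ polynomial DNF gadgets ⇒ Tardos gap) -/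

section FixedWidth

variable {ι : Type*}

/-- Position-locality of a monotone gate transfers to WIRE-locality by monotonicity: the image of a small
accepted position set is a small accepted wire set. [folklore] -/
theorem wireLocal_of_posLocal [DecidableEq ι] (g : Gate ι) (hmono : Monotone g.op) {L : ℕ}
    (hpos : ∀ z : Fin g.arity → Bool, g.op z = true →
      ∃ t₀ : Finset (Fin g.arity), t₀.card ≤ L ∧ (∀ a ∈ t₀, z a = true) ∧
        g.op (fun a => decide (a ∈ t₀)) = true)
    (S : Finset (ι ⊕ ℕ)) (hS : ∀ a, g.args a ∈ S) (y : ι ⊕ ℕ → Bool)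
    (hy : g.op (fun a => y (g.args a)) = true) :
    ∃ t : Finset (ι ⊕ ℕ), t ⊆ S ∧ t.card ≤ L ∧ (∀ w ∈ t, y w = true) ∧
      g.op (fun a => decide (g.args a ∈ t)) = true := by
  obtain ⟨t₀, hL, hon, hacc⟩ := hpos _ hy
  refine ⟨t₀.image g.args, ?_, Finset.card_image_le.trans hL, ?_, ?_⟩
  · intro w hw
    obtain ⟨a, -, rfl⟩ := Finset.mem_image.1 hw
    exact hS a
  · intro w hw
    obtain ⟨a, ha, rfl⟩ := Finset.mem_image.1 hw
    exact hon a ha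
  · refine eq_true_of_le_of_eq_true (hmono fun a => ?_) hacc
    by_cases ha : a ∈ t₀
    · simp [ha, Finset.mem_image_of_mem g.args ha]
    · simp [ha]

/-- Any gate of arity `≤ L` is `L`-local in positions. [folklore] -/
theorem posLocal_of_arity_le (g : Gate ι) {L : ℕ} (hL : g.arity ≤ L) (z : Fin g.arity → Bool)
    (hz : g.op z = true) :
    ∃ t₀ : Finset (Fin g.arity), t₀.card ≤ L ∧ (∀ a ∈ t₀, z a = true) ∧
      g.op (fun a => decide (a ∈ t₀)) = true := by
  refine ⟨Finset.univ.filter fun a => z a = true, ?_, fun a ha => (Finset.mem_filter.1 ha).2, ?_⟩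
  · refine (Finset.card_filter_le _ _).trans ?_
    rw [Finset.card_univ, Fintype.card_fin]
    exact hL
  · convert hz using 2
    ext a
    simp

/-- The target basis of strengthening S₃ at size parameter `N`: `∧₂, ∨₂`, CONV gates of width `≤ N` but
fan-in `≤ k`, and PERM / GRANK gates of FIXED width `s₀` (any fan-in). [folklore] -/
def fixedWidthBasis (s₀ k N : ℕ) : Set GateFn :=
  {g | g = GateFn.and 2 ∨ g = GateFn.or 2 ∨ (IsConvGate N g ∧ g.1 ≤ k) ∨ IsPermGate s₀ g ∨
    IsGRankGate s₀ g}

/-- Every gate of the S₃ basis is monotone. [folklore] -/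
theorem monotone_of_mem_fixedWidthBasis {s₀ k N : ℕ} {g : GateFn} (hg : g ∈ fixedWidthBasis s₀ k N) :
    Monotone g.2 := by
  rcases hg with rfl | rfl | ⟨h, -⟩ | h | h
  · exact GateFn.and_monotone 2
  · exact GateFn.or_monotone 2
  · exact h.monotone
  · exact h.monotone
  · exact h.monotone

/-- Every gate of the S₃ basis is `(k + s₀! + s₀ + 2)`-local in positions. [folklore] -/
theorem posLocal_of_mem_fixedWidthBasis {s₀ k N : ℕ} (g : Gate ι)
    (hg : g.fn ∈ fixedWidthBasis s₀ k N) (z : Fin g.arity → Bool) (hz : g.op z = true) :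
    ∃ t₀ : Finset (Fin g.arity), t₀.card ≤ k + s₀.factorial + s₀ + 2 ∧ (∀ a ∈ t₀, z a = true) ∧
      g.op (fun a => decide (a ∈ t₀)) = true := by
  rcases hg with h | h | ⟨-, hk⟩ | h | h
  · exact posLocal_of_arity_le g (by rw [show g.arity = 2 from congrArg Sigma.fst h]; omega) z hz
  · exact posLocal_of_arity_le g (by rw [show g.arity = 2 from congrArg Sigma.fst h]; omega) z hz
  · exact posLocal_of_arity_le g (le_trans hk (by omega)) z hz
  · obtain ⟨t, ht, hon, hacc⟩ := IsPermGate.local h z hz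
    have h1 : t.card ≤ s₀.factorial := (Nat.lt_two_pow_self).le.trans ht
    exact ⟨t, le_trans h1 (by omega), hon, hacc⟩
  · obtain ⟨t, ht, hon, hacc⟩ := IsGRankGate.local h z hz
    exact ⟨t, le_trans ht (by omega), hon, hacc⟩

/-- STRENGTHENING S₃ of the crux: capture into `fixedWidthBasis s₀ k N`. [folklore] -/
def CaptureFixedWidth (s₀ k : ℕ) : Prop :=
  ∃ a : ℕ, ∀ (ι : Type) (_ : Fintype ι) (f : (ι → Bool) → Bool), Monotone f →
    ∀ C : Circuit ι, C.IsOver B2 → C.Computes f →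
      ∃ C' : Circuit ι, C'.IsOver (fixedWidthBasis s₀ k ((C.size + Fintype.card ι + 2) ^ a)) ∧
        C'.size ≤ (C.size + Fintype.card ι + 2) ^ a ∧ C'.Computes f

/-- The wires available to a well-formed program: inputs and its own gates. [folklore] -/
theorem args_mem_wireSet [Fintype ι] [DecidableEq ι] (C : Circuit ι) {g : Gate ι} (hg : g ∈ C.gates)
    (a : Fin g.arity) :
    g.args a ∈ (Finset.univ.image Sum.inl ∪ (Finset.range C.size).image Sum.inr : Finset (ι ⊕ ℕ)) := by
  obtain ⟨j, hj, rfl⟩ := List.mem_iff_getElem.1 hg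
  rcases h : (C.gates[j]).args a with i | m
  · exact Finset.mem_union_left _ (Finset.mem_image_of_mem _ (Finset.mem_univ i))
  · refine Finset.mem_union_right _ (Finset.mem_image_of_mem _ (Finset.mem_range.2 ?_))
    exact (C.wf j hj a m h).trans hj

/-- Size of that wire set: `≤ |ι| + size`. [folklore] -/
theorem card_wireSet_le [Fintype ι] [DecidableEq ι] (C : Circuit ι) :
    (Finset.univ.image Sum.inl ∪ (Finset.range C.size).image Sum.inr : Finset (ι ⊕ ℕ)).card ≤
      Fintype.card ι + C.size :=
  (Finset.card_union_le _ _).trans (add_le_add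
    (Finset.card_image_le.trans (by rw [Finset.card_univ]))
    (Finset.card_image_le.trans (by rw [Finset.card_range])))

/-- Size bookkeeping for S₃: `1 + localBound (n + M^a) L · M^a ≤ (v + t)^{3((a+1)L + a) + 1}` for
`M = t + n + 2`, `n ≤ v²`, `v ≥ L + 4`. [folklore] -/
theorem size_bookkeeping_fixed {v t n a L : ℕ} (hv : 2 ≤ v) (hvL : L + 4 ≤ v) (hn : n ≤ v ^ 2) :
    1 + localBound (n + (t + n + 2) ^ a) L * (t + n + 2) ^ a ≤
      (v + t) ^ (3 * ((a + 1) * L + a) + 1) := by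
  set M := t + n + 2 with hMdef
  have hM1 : 1 ≤ M := by omega
  have hMa : 1 ≤ M ^ a := Nat.one_le_pow _ _ hM1
  have hM3 : M ≤ (v + t) ^ 3 := by
    have h1 : v ^ 2 + 2 ≤ v ^ 3 := by nlinarith
    have h2 : v ^ 3 + t ≤ (v + t) ^ 3 := by
      have h3 : 1 ≤ 3 * v ^ 2 + 3 * v * t + t ^ 2 := by nlinarith
      calc v ^ 3 + t = v ^ 3 + t * 1 := by ring
        _ ≤ v ^ 3 + t * (3 * v ^ 2 + 3 * v * t + t ^ 2) := by gcongr
        _ = (v + t) ^ 3 := by ring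
    omega
  have hR : n + M ^ a + 1 ≤ M ^ (a + 1) := by
    have h2 : (n + 2) * M ^ a ≤ M * M ^ a := Nat.mul_le_mul_right _ (by omega)
    rw [pow_succ']
    nlinarith [h2, hMa]
  set e := (a + 1) * L + a with he
  have hpow : (M ^ (a + 1)) ^ L * M ^ a = M ^ e := by rw [← pow_mul, ← pow_add]
  have hMe : 1 ≤ M ^ e := Nat.one_le_pow _ _ hM1
  have hMae : M ^ a ≤ M ^ e := Nat.pow_le_pow_right hM1 (Nat.le_add_left _ _)
  calc 1 + localBound (n + M ^ a) L * M ^ a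
      ≤ 1 + ((M ^ (a + 1)) ^ L * (L + 2) + 1) * M ^ a := by unfold localBound; gcongr
    _ = 1 + ((M ^ (a + 1)) ^ L * M ^ a * (L + 2) + M ^ a) := by ring
    _ = 1 + (M ^ e * (L + 2) + M ^ a) := by rw [hpow]
    _ ≤ M ^ e + (M ^ e * (L + 2) + M ^ e) := by gcongr
    _ = (L + 4) * M ^ e := by ring
    _ ≤ (v + t) * ((v + t) ^ 3) ^ e := Nat.mul_le_mul (by omega) (Nat.pow_le_pow_left hM3 e)
    _ = (v + t) ^ (3 * e + 1) := by rw [← pow_mul, ← pow_succ']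

/-- **STRENGTHENING S₃ is FALSE for every `s₀, k`.** PERM and GRANK gates of a FIXED width `s₀` — of any
fan-in — together with `∧₂, ∨₂` and CONV gates of fan-in `≤ k` cannot capture monotone P/poly: every
such gate is `L`-local for the constant `L = k + s₀! + s₀ + 2` (`GateLocality.lean`), hence a `{∧₂,∨₂,0,1}`-gadget of
size `localBound (n + N) L`, polynomial in `N` (§2); rebase (`BoundedFanIn.Circuit.rebase'`), eliminate constants, and the Tardos gap
(`not_monotoneTransfer_pow_holds`) refutes the resulting polynomial transfer. So any proof of `Capture`
must use PERM/GRANK gates of GROWING width or CONV gates of unbounded fan-in — the width parameter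
`(t+n+2)^a` inside `Ext` is load-bearing for the linear-algebra gates, not only for CONV. [folklore] -/
theorem not_captureFixedWidth (s₀ k : ℕ) : ¬ CaptureFixedWidth s₀ k := by
  classical
  rintro ⟨a, h⟩
  set L := k + s₀.factorial + s₀ + 2 with hL
  refine not_monotoneTransfer_pow_holds (3 * ((a + 1) * L + a) + 1) ?_
  filter_upwards [eventually_ge_atTop (L + 4)] with v hv f hf C hB hC
  obtain ⟨C', h1, h2, h3⟩ := h _ inferInstance f hf C (hB.mono deMorganBasis_subset_B2) hC
  set n := Fintype.card ((⊤ : SimpleGraph (Fin v)).edgeSet) with hn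
  set N := (C.size + n + 2) ^ a with hN
  let S : Finset (((⊤ : SimpleGraph (Fin v)).edgeSet) ⊕ ℕ) :=
    Finset.univ.image Sum.inl ∪ (Finset.range C'.size).image Sum.inr
  have hScard : S.card ≤ n + N := (card_wireSet_le C').trans (by omega)
  -- rebase `C'` gate by gate into `{∧₂,∨₂,0,1}` through the locality gadgets
  obtain ⟨C'', hB'', hs'', he''⟩ := Circuit.rebase' (const_mem_monotoneBasis01 false)
    (localBound (n + N) L) C' fun g hg => by
      have hgB := h1 g hg
      have hmono : Monotone g.op := monotone_of_mem_fixedWidthBasis hgB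
      refine (cktSize_of_wireLocal (fun y => g.op fun a => y (g.args a))
        (fun y y' hyy' => hmono fun a => hyy' (g.args a)) S L ?_).of_le (localBound_mono_left hScard L)
      exact wireLocal_of_posLocal g hmono (posLocal_of_mem_fixedWidthBasis g hgB) S
        (args_mem_wireSet C' hg)
  -- eliminate the constants
  rcases const_or_exists_monotone_circuit C''.gates C''.output (wf_gates C'') hB'' C''.wf_output with
    ⟨b, hb⟩ | ⟨D, hDB, hDs, hDe⟩
  · have hfb : f = fun _ => b := funext fun x => by rw [← h3 x, ← he'' x, circuit_eval, hb x]
    rw [hfb, circuitSizeOver_monotoneBasis_const]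
    exact Nat.zero_le _
  · calc circuitSizeOver monotoneBasis f ≤ D.size :=
          circuitSizeOver_le_of_computes D hDB fun x => by rw [hDe, ← circuit_eval, he'', h3]
      _ ≤ C''.size := hDs
      _ ≤ 1 + localBound (n + N) L * C'.size := hs''
      _ ≤ 1 + localBound (n + N) L * N := by gcongr
      _ ≤ (v + C.size) ^ (3 * ((a + 1) * L + a) + 1) :=
          size_bookkeeping_fixed (by omega) hv (card_edgeSet_top_le' v)

end FixedWidth

end Summit.PneNP.PneNP.Theorems.Capture.Negative
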